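import Summits.CriticalPhenomena.PercolationContinuityZ3.Theorems.Transplant.AutDiscreteWallCayley
import HarnessLib

/-!
# The discrete wall, III: EVERY skeleton of the ladder — any number of types — yields QUASI-TRANSITIVE off-wall data, so under a discrete automorphism
# group the virtual criterion and the necessity of `vb₁(Γ) ≥ 2` hold for EVERY node, not only for the one-type node

builds on p205010 (kernel theorem, internal audit signed; external expert review pending) — nothing in this file uses p205010; no node is assumed
(sections 1–3 are UNCONDITIONAL; the last theorem is conditional on the Literature named fact `LeemannDeLaSalle2022_discreteCayleyGraph` (p403247) only).  Lane `prim-bschramm`,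
seat `prim-bschramm-p4` gen 26 (PART C3 of `P4-GENERAL.md` §48.10).  Helper file (`--supports stmt-CriticalPhenomena-4575 --as helper`).

THE POINT.  Gen 24 unpacked the ONE-TYPE interface (`FrmScaledAut.translating_transitive_rankTwo`: the chart-translating group `A_φ` is TRANSITIVE with two
independent characters); gen 26 (`AutDiscrete.offWall_descends`, `exists_finiteIndex_rankTwo_of_offWall`) showed that under a finite `Aut`-stabiliser such data
descend to a finite-index subgroup of ANY transitive `Γ ≤ Aut(G)`.  Here, for ANY NUMBER OF TYPES (the planners' multi-type node (M) included):
(1) `skeleton_translating_finiteOrbits_rankTwo` — `A_φ` is QUASI-TRANSITIVE (the types are orbit representatives), its translation character `α ↦ φ(α t) − φ t`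
kills EVERY vertex stabiliser of `A_φ` and has RANK TWO, by pigeonhole along the two exact-step chains (abstract forms `exists_translating_nsmul_of_step` /
`exists_translating_rankTwo_of_steps`: a chart framed by finitely many types + step MAPS raising it by independent vectors; adjacency is never used, so
quasi-steps along paths give the same); (2) `offWall_descends_of_finite_orbits` — off-wall data of a subgroup with FINITELY MANY ORBITS descend, under a finite
stabiliser, to a finite-index subgroup (index `≤ |X|·|Stab(t)|`) of any transitive `Γ`; (3) `offWall_descends_of_frmScaled` / **`isEmpty_frmScaled_of_virtually`:
if ONE transitive `Γ ≤ Aut(G)` (finite `Aut`-stabiliser) has no finite-index subgroup with a rank-two `ℤ²`-character killing its stabiliser, then `G` carries NO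
`PlanarSkeletonFrmScaled` of any number of types**; Cayley form **`exists_finiteIndex_rankTwo_of_frmScaled`: finite `Stab(1)` + ANY skeleton ⟹ `vb₁(Γ) ≥ 2`**
(index `≤ |types|·|Stab(1)|`; LdlS customer `exists_cayley_vb1_of_frmScaled`).  So on Cayley graphs with discrete automorphism group the WHOLE ladder is pinned
between `b₁(Γ) ≥ 2` (sufficient, one type, gen 17) and `vb₁(Γ) ≥ 2` (necessary, every node): beyond the one-type node, (M) can add only the wall groups
`b₁ ≤ 1 < vb₁`.  (5) QUASI-TRANSITIVE `Γ` (Benjamini–Schramm's generality — `Γ = Aut(G)` discrete, the lattice of a periodic net, …): the same descent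
(`offWall_descends_of_finite_orbits₂`, `offWall_descends_of_frmScaled_qt`), the virtual criterion `isEmpty_frmScaled_of_virtually_qt`, and **`vb₁ ≥ 2` for EVERY
group acting with finitely many orbits on a graph with a finite `Aut`-stabiliser that carries a skeleton** (`exists_finiteIndex_rankTwo_of_frmScaled_qt`;
headline `aut_virtually_rankTwo_of_frmScaled` for `Aut(G)` itself).
DESIGN: like its parent `AutDiscreteWallCayley`, this file does not import `AutDiscreteWall` (transitive lemmas = the case `X = {1}` of the quasi-transitive ones).
NEAREST PRIOR ART: Grimmett–Li, EJC 24 (2017) P4.38, Prop. 18(b),(c) (`Stab₁ = Π`: a graph height function with a finite-index `H ◁ Aut` restricts to a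
finite-index normal subgroup of `Γ` — the `ℤ`-valued, `Stab₁ = Π` shadow of (3)); the group theory is folklore.
[cite: GrimmettLi2017Amenability, Prop. 18] [cite: BenjaminiSchramm1996, Conj. 4; §2 (almost transitive graphs, Cayley graphs)] [cite: LeemannDelasalle2022, Cor. 1.3]
-/

noncomputable section

namespace Summit.CriticalPhenomena.PercolationContinuityZ3.Theorems.Transplant

open SimpleGraph Literature.Probability.LatticeModels
open scoped Classical

namespace AutDiscrete

/-! ### §1. Off-wall data of a subgroup with finitely many orbits descend to every transitive subgroup, virtually -/

section WallQT

variable {B : Type} [Group B] {V : Type} [MulAction B V] {t : V}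

/-- A subgroup with finitely many orbits on the orbit of `t` (finite stabiliser) meets EVERY subgroup `Γ` in a subgroup of FINITE index of `Γ`. [folklore] -/
theorem relIndex_ne_zero_of_finite_orbits (A Γ : Subgroup B) (X : Finset B) (hX : ∀ b : B, ∃ x ∈ X, ∃ a ∈ A, a • x • t = b • t)
    [Finite (MulAction.stabilizer B t)] : A.relIndex Γ ≠ 0 :=
  fun h => index_ne_zero_of_finite_orbits A X hX (by rw [← Subgroup.relIndex_top_right]; exact Subgroup.relIndex_eq_zero_of_le_right le_top h)

/-- … of index `[Γ : A ∩ Γ] ≤ |X| · |Stab(t)|`. [folklore] -/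
theorem relIndex_le_of_finite_orbits (A Γ : Subgroup B) (X : Finset B) (hX : ∀ b : B, ∃ x ∈ X, ∃ a ∈ A, a • x • t = b • t)
    [Finite (MulAction.stabilizer B t)] : A.relIndex Γ ≤ X.card * Nat.card (MulAction.stabilizer B t) :=
  (Subgroup.relIndex_le_of_le_right (H := A) (K := Γ) le_top
      (by rw [Subgroup.relIndex_top_right]; exact index_ne_zero_of_finite_orbits A X hX)).trans
    (by rw [Subgroup.relIndex_top_right]; exact index_le_of_finite_orbits A X hX)

/-- **OFF-WALL DATA OF A QUASI-TRANSITIVE SUBGROUP DESCEND TO EVERY TRANSITIVE SUBGROUP, VIRTUALLY**: `B` with finite `Stab(t)`; `A ≤ B` with finitely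
many orbits on `B • t` (representatives `x • t`, `x ∈ X`) carrying `c : A → ℤ²` of rank two killing `Stab_A(t)`; `Γ ≤ B` transitive ⟹ `A ∩ Γ` has index
`≤ |X| · |Stab(t)|` in `Γ` and `c|_{A ∩ Γ}` has rank two (on powers of the rank witnesses) and kills `Stab_{A ∩ Γ}(t)` (transitive `A`: `offWall_descends`).
[cite: BenjaminiSchramm1996, §2 (almost transitive graphs)] [cite: GrimmettLi2017Amenability, Prop. 18(b)] -/
theorem offWall_descends_of_finite_orbits (A Γ : Subgroup B) (X : Finset B) (hX : ∀ b : B, ∃ x ∈ X, ∃ a ∈ A, a • x • t = b • t)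
    (htrΓ : ∀ v : V, ∃ γ ∈ Γ, γ • t = v) [Finite (MulAction.stabilizer B t)] (c : A →* Multiplicative (Site 2))
    (hstab : ∀ h : A, (h : B) • t = t → c h = 1) (hrank : ∃ x y : A, MaxArea.det2 (Multiplicative.toAdd (c x)) (Multiplicative.toAdd (c y)) ≠ 0) :
    (A ⊓ Γ).relIndex Γ ≠ 0 ∧ (A ⊓ Γ).relIndex Γ ≤ X.card * Nat.card (MulAction.stabilizer B t) ∧
      ∃ c' : ↥(A ⊓ Γ) →* Multiplicative (Site 2), (∀ h : ↥(A ⊓ Γ), (h : B) • t = t → c' h = 1) ∧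
        ∃ x y : ↥(A ⊓ Γ), MaxArea.det2 (Multiplicative.toAdd (c' x)) (Multiplicative.toAdd (c' y)) ≠ 0 := by
  refine ⟨by rw [Subgroup.inf_relIndex_right]; exact relIndex_ne_zero_of_finite_orbits A Γ X hX,
    by rw [Subgroup.inf_relIndex_right]; exact relIndex_le_of_finite_orbits A Γ X hX, c.comp (Subgroup.inclusion inf_le_left), fun h hh => hstab _ hh, ?_⟩
  obtain ⟨x, y, hxy⟩ := hrank
  have hY : ∀ b : B, ∃ y ∈ ({1} : Finset B), ∃ γ ∈ Γ, γ • y • t = b • t := (fun b => by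
    obtain ⟨γ, hγ, h⟩ := htrΓ (b • t); exact ⟨1, Finset.mem_singleton_self _, γ, hγ, by rw [one_smul]; exact h⟩)
  obtain ⟨m, hm, -, hxm⟩ := exists_pow_mem_of_finite_orbits Γ {1} hY (x : B)
  obtain ⟨n, hn, -, hyn⟩ := exists_pow_mem_of_finite_orbits Γ {1} hY (y : B)
  refine ⟨⟨(x : B) ^ m, A.pow_mem x.2 m, hxm⟩, ⟨(y : B) ^ n, A.pow_mem y.2 n, hyn⟩, ?_⟩
  have ex : (c.comp (Subgroup.inclusion inf_le_left)) ⟨(x : B) ^ m, A.pow_mem x.2 m, hxm⟩ = c (x ^ m) :=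
    congrArg c (Subtype.ext (by simp))
  have ey : (c.comp (Subgroup.inclusion inf_le_left)) ⟨(y : B) ^ n, A.pow_mem y.2 n, hyn⟩ = c (y ^ n) :=
    congrArg c (Subtype.ext (by simp))
  have hdet (m n : ℕ) (u v : Site 2) : MaxArea.det2 (m • u) (n • v) = (m : ℤ) * n * MaxArea.det2 u v := by simp only [MaxArea.det2, Pi.smul_apply, nsmul_eq_mul]; ring
  rw [ex, ey, map_pow c x m, map_pow c y n, toAdd_pow, toAdd_pow, hdet]
  exact mul_ne_zero (mul_ne_zero (by exact_mod_cast hm.ne') (by exact_mod_cast hn.ne')) hxy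

end WallQT

/-! ### §2. Every skeleton, any number of types, yields a QUASI-TRANSITIVE chart-translating group with a stabiliser-killing character of rank two -/

section Skeleton

variable {V : Type} {G : SimpleGraph V} [G.LocallyFinite]

omit [G.LocallyFinite] in
/-- **Pigeonhole along a step chain (abstract form — steps of ANY shape).**  A chart `φ : V → ℤ²` framed by finitely many types `T` through the
chart-translating group `A`, and a self-map `next` of `V` raising `φ` by a fixed vector `d` (a single-edge step, a scaled step, a quasi-step along a path —
adjacency is NOT used): two vertices of the chain `next^[k] t` of the same type differ by an element of `A` translating by a POSITIVE multiple of `d`.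
[cite: BenjaminiSchramm1996, §2 (almost transitive graphs)] -/
theorem exists_translating_nsmul_of_step (φ : V → Site 2) (T : Finset V)
    (hframe : ∀ v : V, ∃ s ∈ T, ∃ α : G ≃g G, α s = v ∧ ∀ w, φ (α w) = φ w + (φ v - φ s)) (A : Subgroup (G ≃g G))
    (hA : ∀ α : G ≃g G, α ∈ A ↔ ∃ d : Site 2, ∀ w, φ (α w) = φ w + d) (t : V) (d : Site 2) (next : V → V)
    (hnext : ∀ w, φ (next w) = φ w + d) : ∃ α ∈ A, ∃ m : ℕ, 0 < m ∧ φ (α t) - φ t = m • d := by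
  have hiter : ∀ k : ℕ, φ (next^[k] t) = φ t + k • d := by
    intro k
    induction k with
    | zero => rw [Function.iterate_zero, id, zero_smul, add_zero]
    | succ k ih => rw [Function.iterate_succ_apply', hnext, ih, add_assoc, ← succ_nsmul]
  -- type and frame of the `k`-th vertex of the chain
  choose s hs α hαs hαw using fun k : ℕ => hframe (next^[k] t)
  have hαA : ∀ k, α k ∈ A := fun k => (hA (α k)).2 ⟨_, hαw k⟩
  -- two vertices of the chain have the same type
  have hnotinj : ¬ Function.Injective fun k : ℕ => (⟨s k, hs k⟩ : ↥T) := not_injective_infinite_finite _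
  obtain ⟨k, l, hkl, hne⟩ : ∃ k l : ℕ, s k = s l ∧ k < l := by
    simp only [Function.Injective, not_forall] at hnotinj
    obtain ⟨k, l, h, hne⟩ := hnotinj
    have h' : s k = s l := congrArg Subtype.val h
    rcases Nat.lt_or_gt_of_ne hne with hlt | hlt
    · exact ⟨k, l, h', hlt⟩
    · exact ⟨l, k, h'.symm, hlt⟩
  -- `β = α_l α_k⁻¹` maps the `k`-th vertex to the `l`-th and translates by `(l - k) • d`
  refine ⟨α l * (α k)⁻¹, A.mul_mem (hαA l) (A.inv_mem (hαA k)), l - k, Nat.sub_pos_of_lt hne, ?_⟩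
  obtain ⟨d', hd'⟩ := (hA _).1 (A.mul_mem (hαA l) (A.inv_mem (hαA k)))
  have hmap : (α l * (α k)⁻¹) (next^[k] t) = next^[l] t := by
    rw [RelIso.coe_mul, Function.comp_apply, ← hαs k, RelIso.inv_apply_self, hkl, hαs l]
  have hdk : d' = φ (next^[l] t) - φ (next^[k] t) := by rw [← hmap, hd']; abel
  have hl : l = (l - k) + k := (Nat.sub_add_cancel hne.le).symm
  rw [hd' t, add_sub_cancel_left, hdk, hiter, hiter, add_sub_add_left_eq_sub, hl, add_nsmul, Nat.add_sub_cancel, add_sub_cancel_right]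

omit [G.LocallyFinite] in
/-- **Two independent step maps force RANK TWO on the chart-translating group (abstract form — steps of ANY shape)**: with `φ`, `T`, `A` as above and
self-maps `next₀`, `next₁` of `V` raising `φ` by `d₀`, `d₁` with `det(d₀, d₁) ≠ 0`, the group `A` contains two elements translating `φ` by independent vectors
(positive multiples of `d₀`, `d₁`).  This is what makes `vb₁ ≥ 2` necessary for every chart-and-steps interface, quasi-steps along paths included.
[cite: BenjaminiSchramm1996, §2 (almost transitive graphs)] -/
theorem exists_translating_rankTwo_of_steps (φ : V → Site 2) (T : Finset V)
    (hframe : ∀ v : V, ∃ s ∈ T, ∃ α : G ≃g G, α s = v ∧ ∀ w, φ (α w) = φ w + (φ v - φ s)) (A : Subgroup (G ≃g G))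
    (hA : ∀ α : G ≃g G, α ∈ A ↔ ∃ d : Site 2, ∀ w, φ (α w) = φ w + d) (t : V) (d₀ d₁ : Site 2) (hd : MaxArea.det2 d₀ d₁ ≠ 0)
    (next₀ next₁ : V → V) (h₀ : ∀ w, φ (next₀ w) = φ w + d₀) (h₁ : ∀ w, φ (next₁ w) = φ w + d₁) :
    ∃ x ∈ A, ∃ y ∈ A, MaxArea.det2 (φ (x t) - φ t) (φ (y t) - φ t) ≠ 0 := by
  obtain ⟨x, hx, m, hm, hxm⟩ := exists_translating_nsmul_of_step φ T hframe A hA t d₀ next₀ h₀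
  obtain ⟨y, hy, n, hn, hyn⟩ := exists_translating_nsmul_of_step φ T hframe A hA t d₁ next₁ h₁
  refine ⟨x, hx, y, hy, ?_⟩
  have hdet (m n : ℕ) (u v : Site 2) : MaxArea.det2 (m • u) (n • v) = (m : ℤ) * n * MaxArea.det2 u v := by simp only [MaxArea.det2, Pi.smul_apply, nsmul_eq_mul]; ring
  rw [hxm, hyn, hdet]
  exact mul_ne_zero (mul_ne_zero (by exact_mod_cast hm.ne') (by exact_mod_cast hn.ne')) hd

/-- Along the exact `eᵢ`-step chain of a skeleton from `t`, two vertices of the SAME TYPE differ by a chart-translating automorphism translating by a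
POSITIVE multiple of `N eᵢ` (`exists_translating_nsmul_of_step` with the skeleton's single-edge steps). [cite: BenjaminiSchramm1996, §2 (almost transitive graphs)] -/
theorem exists_translating_nsmul_single (Φ : PlanarSkeletonFrmScaled G) (A : Subgroup (G ≃g G))
    (hA : ∀ α : G ≃g G, α ∈ A ↔ ∃ d : Site 2, ∀ w, Φ.φ (α w) = Φ.φ w + d) (t : V) (i : Fin 2) :
    ∃ α ∈ A, ∃ m : ℕ, 0 < m ∧ Φ.φ (α t) - Φ.φ t = m • (Pi.single i (Φ.N : ℤ) : Site 2) := by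
  choose next hnext using fun w : V => Φ.step w i 1
  exact exists_translating_nsmul_of_step Φ.φ Φ.types Φ.frame A hA t _ next fun w => by rw [(hnext w).2, Units.val_one, mul_one]

/-- **EVERY SKELETON, ANY NUMBER OF TYPES, UNPACKED**: for every `PlanarSkeletonFrmScaled Φ` on `G` and every base vertex `t`, the chart-translating
automorphisms form a subgroup `A ≤ Aut(G)` which (i) translates the chart, `φ(α w) = φ w + (φ(α t) − φ t)`; (ii) is QUASI-TRANSITIVE — every vertex is an
`A`-image of one of the finitely many types; (iii) carries the character `c : α ↦ φ(α t) − φ t`, which (iv) kills the stabiliser in `A` of EVERY vertex and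
(v) has RANK TWO.  (One type: `FrmScaledAut.translating_transitive_rankTwo`, gen 24.)  Stabilisers of `A` need not be finite.
[cite: BenjaminiSchramm1996, §2 (almost transitive graphs); Conj. 4] [cite: KozmaNitzan2024, §4 p. 16 (Lemma 8)] -/
theorem skeleton_translating_finiteOrbits_rankTwo (Φ : PlanarSkeletonFrmScaled G) (t : V) :
    ∃ A : Subgroup (G ≃g G),
      (∀ α ∈ A, ∀ w, Φ.φ (α w) = Φ.φ w + (Φ.φ (α t) - Φ.φ t)) ∧
      (∀ v : V, ∃ s ∈ Φ.types, ∃ α ∈ A, α s = v) ∧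
      ∃ c : A →* Multiplicative (Site 2),
        (∀ a : A, Multiplicative.toAdd (c a) = Φ.φ ((a : G ≃g G) t) - Φ.φ t) ∧
        (∀ (u : V) (a : A), (a : G ≃g G) u = u → c a = 1) ∧
        ∃ x y : A, MaxArea.det2 (Multiplicative.toAdd (c x)) (Multiplicative.toAdd (c y)) ≠ 0 := by
  obtain ⟨A, hA⟩ := FrmScaledAut.exists_translatingSubgroup (G := G) Φ.φ
  have htrans : ∀ α ∈ A, ∀ u w, Φ.φ (α w) = Φ.φ w + (Φ.φ (α u) - Φ.φ u) := by
    intro α hα u w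
    obtain ⟨d, hd⟩ := (hA α).1 hα
    rw [hd w, hd u, add_sub_cancel_left]
  have hframe : ∀ v : V, ∃ s ∈ Φ.types, ∃ α ∈ A, α s = v := by
    intro v
    obtain ⟨s, hs, α, hαs, hαw⟩ := Φ.frame v
    exact ⟨s, hs, α, (hA α).2 ⟨_, hαw⟩, hαs⟩
  letI : MulAction (G ≃g G) V := AutChart.autMulAction G
  let c : A →* Multiplicative (Site 2) := AutChart.chartHom t Φ.φ (fun (a : A) w => htrans a a.2 t w)
  have hc : ∀ a : A, Multiplicative.toAdd (c a) = Φ.φ ((a : G ≃g G) t) - Φ.φ t := fun a => AutChart.toAdd_chartHom _ _ _ a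
  refine ⟨A, fun α hα w => htrans α hα t w, hframe, c, hc, fun u a hu => ?_, ?_⟩
  · -- the translation vector of `a` is `φ(a u) − φ u = 0`
    have h0 : Multiplicative.toAdd (c a) = 0 := by
      rw [hc, htrans a a.2 u t, hu, sub_self, add_zero, sub_self]
    rw [← ofAdd_toAdd (c a), h0, ofAdd_zero]
  · obtain ⟨x, hx, m, hm, hxm⟩ := exists_translating_nsmul_single Φ A hA t 0
    obtain ⟨y, hy, n, hn, hyn⟩ := exists_translating_nsmul_single Φ A hA t 1
    refine ⟨⟨x, hx⟩, ⟨y, hy⟩, ?_⟩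
    have hN : (Φ.N : ℤ) ≠ 0 := by have := Φ.one_le_N; omega
    rw [hc, hc, Subgroup.coe_mk, Subgroup.coe_mk, hxm, hyn]
    simp only [MaxArea.det2, Pi.smul_apply, Pi.single_eq_same, Pi.single_eq_of_ne (by decide : (1 : Fin 2) ≠ 0),
      Pi.single_eq_of_ne (by decide : (0 : Fin 2) ≠ 1), nsmul_eq_mul, mul_zero, sub_zero, ne_eq]
    exact mul_ne_zero (mul_ne_zero (by exact_mod_cast hm.ne') hN) (mul_ne_zero (by exact_mod_cast hn.ne') hN)

/-! ### §3. The virtual criterion and the necessity of `vb₁ ≥ 2` for EVERY node of the ladder -/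

/-- **SKELETON DATA DESCEND TO EVERY TRANSITIVE GROUP OF AUTOMORPHISMS, VIRTUALLY**: a finite vertex stabiliser `{α | α t = t}` in `Aut(G)`, a skeleton `Φ` of
any number of types, and a transitive `Γ ≤ Aut(G)` give a subgroup `Γ₀ ≤ Γ` of index `≤ |types| · |Stab(t)|` with a `ℤ²`-character of rank two killing
`Stab_{Γ₀}(t)` (namely `Γ₀ = A_φ ∩ Γ`). [cite: BenjaminiSchramm1996, Conj. 4; §2] [cite: GrimmettLi2017Amenability, Prop. 18(b),(c)] -/
theorem offWall_descends_of_frmScaled (t : V) (hfin : {α : G ≃g G | α t = t}.Finite) (Φ : PlanarSkeletonFrmScaled G) (Γ : Subgroup (G ≃g G))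
    (htrΓ : ∀ v : V, ∃ γ ∈ Γ, γ t = v) :
    ∃ Γ₀ : Subgroup (G ≃g G), Γ₀ ≤ Γ ∧ Γ₀.relIndex Γ ≠ 0 ∧ Γ₀.relIndex Γ ≤ Φ.types.card * {α : G ≃g G | α t = t}.ncard ∧
      ∃ c : Γ₀ →* Multiplicative (Site 2), (∀ h : Γ₀, (h : G ≃g G) t = t → c h = 1) ∧
        ∃ x y : Γ₀, MaxArea.det2 (Multiplicative.toAdd (c x)) (Multiplicative.toAdd (c y)) ≠ 0 := by
  letI : MulAction (G ≃g G) V := AutChart.autMulAction G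
  have e : (MulAction.stabilizer (G ≃g G) t : Set (G ≃g G)) = {α : G ≃g G | α t = t} := by
    ext α; exact MulAction.mem_stabilizer_iff
  haveI : Finite (MulAction.stabilizer (G ≃g G) t) := (e ▸ hfin).to_subtype
  have hcard : Nat.card (MulAction.stabilizer (G ≃g G) t) = {α : G ≃g G | α t = t}.ncard := by
    rw [← Nat.card_coe_set_eq]
    exact Nat.card_congr (Equiv.subtypeEquivRight fun α => (MulAction.mem_stabilizer_iff : α ∈ MulAction.stabilizer (G ≃g G) t ↔ _))
  obtain ⟨A, -, hqt, c, -, hstab, hrank⟩ := skeleton_translating_finiteOrbits_rankTwo Φ t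
  -- orbit representatives INSIDE `Aut(G)`: `γ_s ∈ Γ` with `γ_s t = s`
  choose γ hγ hγt using fun s : V => htrΓ s
  obtain ⟨h0, hle, c', hc', x', y', hne⟩ := offWall_descends_of_finite_orbits (t := t) A Γ (Φ.types.image γ)
    (fun β => by
      obtain ⟨s, hs, α, hα, hαs⟩ := hqt (β t)
      exact ⟨γ s, Finset.mem_image_of_mem γ hs, α, hα, by change α ((γ s) t) = β t; rw [hγt s, hαs]⟩)
    htrΓ c (fun h hh => hstab t h hh) hrank
  refine ⟨A ⊓ Γ, inf_le_right, h0, hle.trans ?_, c', hc', x', y', hne⟩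
  rw [hcard]
  exact Nat.mul_le_mul_right _ Finset.card_image_le

/-- **THE VIRTUAL CRITERION FOR EVERY NODE OF THE LADDER**: if `Aut(G)` has a finite vertex stabiliser and ONE transitive `Γ ≤ Aut(G)` has NO finite-index
subgroup carrying a rank-two `ℤ²`-character that kills its stabiliser of `t` (e.g. `Γ` torsion; `Γ` acting freely with every finite-index subgroup of first Betti
number `≤ 1`), then `G` carries NO `PlanarSkeletonFrmScaled` of ANY number of types — neither the one-type nodes U_s ⟸ U ⟸ N2 nor the multi-type node (M) has
an instance on `G` (one type: `AutDiscrete.no_oneType_skeleton_at_of_virtually`). [cite: BenjaminiSchramm1996, Conj. 4; §2] -/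
theorem isEmpty_frmScaled_of_virtually (t : V) (hfin : {α : G ≃g G | α t = t}.Finite) (Γ : Subgroup (G ≃g G)) (htrΓ : ∀ v : V, ∃ γ ∈ Γ, γ t = v)
    (hΓ : ∀ Γ₀ : Subgroup (G ≃g G), Γ₀ ≤ Γ → Γ₀.relIndex Γ ≠ 0 → ∀ c : Γ₀ →* Multiplicative (Site 2),
      (∀ h : Γ₀, (h : G ≃g G) t = t → c h = 1) → ∀ x y : Γ₀, MaxArea.det2 (Multiplicative.toAdd (c x)) (Multiplicative.toAdd (c y)) = 0) :
    IsEmpty (PlanarSkeletonFrmScaled G) :=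
  ⟨fun Φ => by
    obtain ⟨Γ₀, hle, h0, -, c, hc, x, y, hne⟩ := offWall_descends_of_frmScaled t hfin Φ Γ htrΓ
    exact hne (hΓ Γ₀ hle h0 c hc x y)⟩

end Skeleton

/-! ### §4. Cayley graphs with discrete automorphism group: `vb₁(Γ) ≥ 2` is necessary for EVERY node -/

section CayleyGraph

variable {Γ : Type} [Group Γ] (S : Finset Γ)

/-- **`vb₁(Γ) ≥ 2` IS NECESSARY FOR EVERY SKELETON NODE (discrete automorphism group)**: if the stabiliser of `1` in `Aut(Cay(Γ; S))` is finite and `Cay(Γ; S)`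
carries a `PlanarSkeletonFrmScaled` of ANY number of types, then `Γ` has a subgroup `Γ₀` of index `≤ |types| · |Stab(1)|` with a homomorphism `Γ₀ → ℤ²` of
rank-two image.  With gen 17's sufficiency of `b₁(Γ) ≥ 2` for the ONE-type node: on such Cayley graphs the reach of the whole ladder is pinned between `b₁ ≥ 2`
and `vb₁ ≥ 2`; beyond the one-type node, the multi-type node can add only the wall groups `b₁ ≤ 1 < vb₁` (one type: `exists_finiteIndex_rankTwo_of_offWall`).
[cite: BenjaminiSchramm1996, Conj. 4; §2 (Cayley graphs)] [cite: LeemannDelasalle2022, Cor. 1.3] [cite: GrimmettLi2017Amenability, Prop. 18(c)] -/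
theorem exists_finiteIndex_rankTwo_of_frmScaled [(mulCayley (S : Set Γ)).LocallyFinite]
    (hfin : {α : mulCayley (S : Set Γ) ≃g mulCayley (S : Set Γ) | α 1 = 1}.Finite) (Φ : PlanarSkeletonFrmScaled (mulCayley (S : Set Γ))) :
    ∃ Γ₀ : Subgroup Γ, Γ₀.index ≠ 0 ∧ Γ₀.index ≤ Φ.types.card * {α : mulCayley (S : Set Γ) ≃g mulCayley (S : Set Γ) | α 1 = 1}.ncard ∧
      ∃ c₀ : Γ₀ →* Multiplicative (Site 2), ∃ x y : Γ₀, MaxArea.det2 (Multiplicative.toAdd (c₀ x)) (Multiplicative.toAdd (c₀ y)) ≠ 0 := by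
  let L : Γ →* (mulCayley (S : Set Γ) ≃g mulCayley (S : Set Γ)) :=
    { toFun := leftMulIso S, map_one' := RelIso.ext fun w => one_mul w, map_mul' := fun g h => RelIso.ext fun w => mul_assoc g h w }
  obtain ⟨Γ₀, hle, h0, hidx, c', -, x', y', hne⟩ :=
    offWall_descends_of_frmScaled (1 : Γ) hfin Φ L.range (fun v => ⟨leftMulIso S v, ⟨v, rfl⟩, mul_one v⟩)
  refine ⟨Γ₀.comap L, ?_, ?_, c'.comp ((L.restrict _).codRestrict Γ₀ fun g => g.2), ?_⟩
  · rwa [Subgroup.index_comap]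
  · rw [Subgroup.index_comap]; exact hidx
  · obtain ⟨gx, hgx⟩ : (x' : mulCayley (S : Set Γ) ≃g mulCayley (S : Set Γ)) ∈ L.range := hle x'.2
    obtain ⟨gy, hgy⟩ : (y' : mulCayley (S : Set Γ) ≃g mulCayley (S : Set Γ)) ∈ L.range := hle y'.2
    have hgx' : gx ∈ Γ₀.comap L := by rw [Subgroup.mem_comap, hgx]; exact x'.2
    have hgy' : gy ∈ Γ₀.comap L := by rw [Subgroup.mem_comap, hgy]; exact y'.2
    refine ⟨⟨gx, hgx'⟩, ⟨gy, hgy'⟩, ?_⟩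
    have ex : (c'.comp ((L.restrict _).codRestrict Γ₀ fun g => g.2)) ⟨gx, hgx'⟩ = c' x' := congrArg c' (Subtype.ext hgx)
    have ey : (c'.comp ((L.restrict _).codRestrict Γ₀ fun g => g.2)) ⟨gy, hgy'⟩ = c' y' := congrArg c' (Subtype.ext hgy)
    rwa [ex, ey]

/-- **EVERY finitely generated group has a Cayley graph on which ANY skeleton of the ladder forces `vb₁(Γ) ≥ 2`** — conditional on Leemann–de la Salle's
Cor. 1.3 (`hL`): some finite generating `S` has `Stab_{Aut(Cay(Γ;S))}(1)` finite, and then every `PlanarSkeletonFrmScaled` on `Cay(Γ; S)` (any number of types)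
yields a finite-index `Γ₀ ≤ Γ` with a homomorphism `Γ₀ → ℤ²` of rank-two image.  Groups with `vb₁ ≤ 1` are therefore outside EVERY node of the ladder on these
Cayley graphs (one type: `exists_cayley_vb1_of_offWall`). [cite: LeemannDelasalle2022, Cor. 1.3] [cite: BenjaminiSchramm1996, Conj. 4; §2 (Cayley graphs)] -/
theorem exists_cayley_vb1_of_frmScaled (hL : Literature.Combinatorics.SimpleGraph.LeemannDeLaSalle2022_discreteCayleyGraph) [Group.FG Γ] :
    ∃ S : Finset Γ, Subgroup.closure (↑S : Set Γ) = ⊤ ∧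
      ∀ Φ : PlanarSkeletonFrmScaled (mulCayley (↑S : Set Γ)),
        ∃ Γ₀ : Subgroup Γ, Γ₀.index ≠ 0 ∧
          ∃ c₀ : Γ₀ →* Multiplicative (Site 2), ∃ x y : Γ₀, MaxArea.det2 (Multiplicative.toAdd (c₀ x)) (Multiplicative.toAdd (c₀ y)) ≠ 0 := by
  obtain ⟨S, hS, hfin⟩ := hL Γ ‹Group.FG Γ›
  refine ⟨S, hS, fun Φ => ?_⟩
  obtain ⟨Γ₀, h0, -, c₀, x, y, hne⟩ := exists_finiteIndex_rankTwo_of_frmScaled S hfin Φ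
  exact ⟨Γ₀, h0, c₀, x, y, hne⟩

end CayleyGraph

/-! ### §5. Quasi-transitive `Γ` (Benjamini–Schramm's generality): the descent, the virtual criterion, `vb₁(Γ) ≥ 2` for every such `Γ` -/

section QuasiTransitiveWall

variable {B : Type} [Group B] {V : Type} [MulAction B V] {t : V}

/-- **Descent to a subgroup `Γ` with FINITELY MANY ORBITS** (instead of transitive): `B` with finite `Stab(t)`; `A ≤ B` with finitely many orbits on `B • t`
(reps `X • t`) and `c : A → ℤ²` of rank two killing the `A`-stabiliser of EVERY point; `Γ ≤ B` with finitely many orbits on `B • t` (reps `Y • t`) ⟹ `A ∩ Γ` has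
index `≤ |X| · |Stab(t)|` in `Γ`, and `c|_{A ∩ Γ}` kills every point stabiliser and has rank two (powers of the witnesses lie in `Γ` by
`exists_pow_mem_of_finite_orbits`). [cite: BenjaminiSchramm1996, §2 (almost transitive graphs)] -/
theorem offWall_descends_of_finite_orbits₂ (A Γ : Subgroup B) (X Y : Finset B) (hX : ∀ b : B, ∃ x ∈ X, ∃ a ∈ A, a • x • t = b • t)
    (hY : ∀ b : B, ∃ y ∈ Y, ∃ γ ∈ Γ, γ • y • t = b • t) [Finite (MulAction.stabilizer B t)] (c : A →* Multiplicative (Site 2))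
    (hstab : ∀ (u : V) (h : A), (h : B) • u = u → c h = 1) (hrank : ∃ x y : A, MaxArea.det2 (Multiplicative.toAdd (c x)) (Multiplicative.toAdd (c y)) ≠ 0) :
    (A ⊓ Γ).relIndex Γ ≠ 0 ∧ (A ⊓ Γ).relIndex Γ ≤ X.card * Nat.card (MulAction.stabilizer B t) ∧
      ∃ c' : ↥(A ⊓ Γ) →* Multiplicative (Site 2), (∀ (u : V) (h : ↥(A ⊓ Γ)), (h : B) • u = u → c' h = 1) ∧
        ∃ x y : ↥(A ⊓ Γ), MaxArea.det2 (Multiplicative.toAdd (c' x)) (Multiplicative.toAdd (c' y)) ≠ 0 := by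
  refine ⟨by rw [Subgroup.inf_relIndex_right]; exact relIndex_ne_zero_of_finite_orbits A Γ X hX,
    by rw [Subgroup.inf_relIndex_right]; exact relIndex_le_of_finite_orbits A Γ X hX, c.comp (Subgroup.inclusion inf_le_left),
    fun u h hh => hstab u _ hh, ?_⟩
  obtain ⟨x, y, hxy⟩ := hrank
  obtain ⟨m, hm, -, hxm⟩ := exists_pow_mem_of_finite_orbits Γ Y hY (x : B)
  obtain ⟨n, hn, -, hyn⟩ := exists_pow_mem_of_finite_orbits Γ Y hY (y : B)
  refine ⟨⟨(x : B) ^ m, A.pow_mem x.2 m, hxm⟩, ⟨(y : B) ^ n, A.pow_mem y.2 n, hyn⟩, ?_⟩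
  have ex : (c.comp (Subgroup.inclusion inf_le_left)) ⟨(x : B) ^ m, A.pow_mem x.2 m, hxm⟩ = c (x ^ m) :=
    congrArg c (Subtype.ext (by simp))
  have ey : (c.comp (Subgroup.inclusion inf_le_left)) ⟨(y : B) ^ n, A.pow_mem y.2 n, hyn⟩ = c (y ^ n) :=
    congrArg c (Subtype.ext (by simp))
  have hdet (m n : ℕ) (u v : Site 2) : MaxArea.det2 (m • u) (n • v) = (m : ℤ) * n * MaxArea.det2 u v := by simp only [MaxArea.det2, Pi.smul_apply, nsmul_eq_mul]; ring
  rw [ex, ey, map_pow c x m, map_pow c y n, toAdd_pow, toAdd_pow, hdet]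
  exact mul_ne_zero (mul_ne_zero (by exact_mod_cast hm.ne') (by exact_mod_cast hn.ne')) hxy

end QuasiTransitiveWall

section QuasiTransitiveGraph

variable {V : Type} {G : SimpleGraph V} [G.LocallyFinite]

/-- **SKELETON DATA DESCEND TO EVERY QUASI-TRANSITIVE GROUP OF AUTOMORPHISMS, VIRTUALLY**: a finite vertex stabiliser `{α | α t = t}` in `Aut(G)`, a skeleton
`Φ` of any number of types, and `Γ ≤ Aut(G)` with FINITELY MANY ORBITS on `V` (met by `R`) give `Γ₀ ≤ Γ` of finite index `≤ |types| · |Stab(t)|` in `Γ` with a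
`ℤ²`-character of rank two killing the `Γ₀`-stabiliser of EVERY vertex (`Γ₀ = A_φ ∩ Γ`). [cite: BenjaminiSchramm1996, Conj. 4; §2 (almost transitive graphs)] -/
theorem offWall_descends_of_frmScaled_qt (t : V) (hfin : {α : G ≃g G | α t = t}.Finite) (Φ : PlanarSkeletonFrmScaled G) (Γ : Subgroup (G ≃g G))
    (R : Finset V) (hR : ∀ v : V, ∃ r ∈ R, ∃ γ ∈ Γ, γ r = v) :
    ∃ Γ₀ : Subgroup (G ≃g G), Γ₀ ≤ Γ ∧ Γ₀.relIndex Γ ≠ 0 ∧ Γ₀.relIndex Γ ≤ Φ.types.card * {α : G ≃g G | α t = t}.ncard ∧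
      ∃ c : Γ₀ →* Multiplicative (Site 2), (∀ (u : V) (h : Γ₀), (h : G ≃g G) u = u → c h = 1) ∧
        ∃ x y : Γ₀, MaxArea.det2 (Multiplicative.toAdd (c x)) (Multiplicative.toAdd (c y)) ≠ 0 := by
  letI : MulAction (G ≃g G) V := AutChart.autMulAction G
  have e : (MulAction.stabilizer (G ≃g G) t : Set (G ≃g G)) = {α : G ≃g G | α t = t} := by
    ext α; exact MulAction.mem_stabilizer_iff
  haveI : Finite (MulAction.stabilizer (G ≃g G) t) := (e ▸ hfin).to_subtype
  have hcard : Nat.card (MulAction.stabilizer (G ≃g G) t) = {α : G ≃g G | α t = t}.ncard := by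
    rw [← Nat.card_coe_set_eq]
    exact Nat.card_congr (Equiv.subtypeEquivRight fun α => (MulAction.mem_stabilizer_iff : α ∈ MulAction.stabilizer (G ≃g G) t ↔ _))
  obtain ⟨A, -, hqt, c, -, hstab, hrank⟩ := skeleton_translating_finiteOrbits_rankTwo Φ t
  -- representatives INSIDE `Aut(G) • t`: for a point `r` reachable from `t` pick `x r ∈ Aut(G)` with `x r t = r`
  choose! x hx using fun (r : V) (h : ∃ β : G ≃g G, β t = r) => h
  have hX : ∀ β : G ≃g G, ∃ x' ∈ Φ.types.image x, ∃ a ∈ A, a • x' • t = β • t := fun β => by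
    obtain ⟨s, hs, α, hα, hαs⟩ := hqt (β t)
    have hreach : ∃ β' : G ≃g G, β' t = s := ⟨α⁻¹ * β, by rw [RelIso.coe_mul, Function.comp_apply, ← hαs, RelIso.inv_apply_self]⟩
    exact ⟨x s, Finset.mem_image_of_mem x hs, α, hα, by change α ((x s) t) = β t; rw [hx s hreach, hαs]⟩
  have hY : ∀ β : G ≃g G, ∃ y ∈ R.image x, ∃ γ ∈ Γ, γ • y • t = β • t := fun β => by
    obtain ⟨r, hr, γ, hγ, hγr⟩ := hR (β t)
    have hreach : ∃ β' : G ≃g G, β' t = r := ⟨γ⁻¹ * β, by rw [RelIso.coe_mul, Function.comp_apply, ← hγr, RelIso.inv_apply_self]⟩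
    exact ⟨x r, Finset.mem_image_of_mem x hr, γ, hγ, by change γ ((x r) t) = β t; rw [hx r hreach, hγr]⟩
  obtain ⟨h0, hle, c', hc', x', y', hne⟩ := offWall_descends_of_finite_orbits₂ (t := t) A Γ _ _ hX hY c (fun u h hh => hstab u h hh) hrank
  refine ⟨A ⊓ Γ, inf_le_right, h0, hle.trans ?_, c', hc', x', y', hne⟩
  rw [hcard]
  exact Nat.mul_le_mul_right _ Finset.card_image_le

/-- **THE VIRTUAL CRITERION FOR QUASI-TRANSITIVE GRAPHS (Benjamini–Schramm's generality), EVERY NODE**: if `Aut(G)` has a finite vertex stabiliser and ONE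
`Γ ≤ Aut(G)` with finitely many orbits (e.g. `Γ = Aut(G)` of a quasi-transitive graph) has NO finite-index subgroup carrying a rank-two `ℤ²`-character that
kills the stabiliser of every vertex, then `G` carries NO `PlanarSkeletonFrmScaled` of any number of types. [cite: BenjaminiSchramm1996, Conj. 4; §2] -/
theorem isEmpty_frmScaled_of_virtually_qt (t : V) (hfin : {α : G ≃g G | α t = t}.Finite) (Γ : Subgroup (G ≃g G)) (R : Finset V)
    (hR : ∀ v : V, ∃ r ∈ R, ∃ γ ∈ Γ, γ r = v)
    (hΓ : ∀ Γ₀ : Subgroup (G ≃g G), Γ₀ ≤ Γ → Γ₀.relIndex Γ ≠ 0 → ∀ c : Γ₀ →* Multiplicative (Site 2),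
      (∀ (u : V) (h : Γ₀), (h : G ≃g G) u = u → c h = 1) →
        ∀ x y : Γ₀, MaxArea.det2 (Multiplicative.toAdd (c x)) (Multiplicative.toAdd (c y)) = 0) :
    IsEmpty (PlanarSkeletonFrmScaled G) :=
  ⟨fun Φ => by
    obtain ⟨Γ₀, hle, h0, -, c, hc, x, y, hne⟩ := offWall_descends_of_frmScaled_qt t hfin Φ Γ R hR
    exact hne (hΓ Γ₀ hle h0 c hc x y)⟩

/-- **EVERY GROUP ACTING WITH FINITELY MANY ORBITS on a graph with a finite `Aut`-stabiliser that carries a skeleton has `vb₁ ≥ 2`** (as an abstract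
group; no freeness needed): `Γ ≤ Aut(G)` quasi-transitive and ANY `PlanarSkeletonFrmScaled` on `G` (any number of types) ⟹ a subgroup of `Γ` of finite index
`≤ |types| · |Stab(t)|` with a homomorphism to `ℤ²` of rank-two image — periodic nets and covering graphs of finite graphs (`Γ` free), quasi-transitive graphs
(`Γ = Aut(G)` discrete), Cayley graphs (`Γ = Γ_L`, `exists_finiteIndex_rankTwo_of_frmScaled`). [cite: BenjaminiSchramm1996, Conj. 4; §2 (almost transitive graphs)] -/
theorem exists_finiteIndex_rankTwo_of_frmScaled_qt (t : V) (hfin : {α : G ≃g G | α t = t}.Finite) (Φ : PlanarSkeletonFrmScaled G)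
    (Γ : Subgroup (G ≃g G)) (R : Finset V) (hR : ∀ v : V, ∃ r ∈ R, ∃ γ ∈ Γ, γ r = v) :
    ∃ Γ₀ : Subgroup Γ, Γ₀.index ≠ 0 ∧ Γ₀.index ≤ Φ.types.card * {α : G ≃g G | α t = t}.ncard ∧
      ∃ c₀ : Γ₀ →* Multiplicative (Site 2), ∃ x y : Γ₀, MaxArea.det2 (Multiplicative.toAdd (c₀ x)) (Multiplicative.toAdd (c₀ y)) ≠ 0 := by
  obtain ⟨Γ₀, hle, h0, hidx, c, -, x, y, hne⟩ := offWall_descends_of_frmScaled_qt t hfin Φ Γ R hR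
  refine ⟨Γ₀.subgroupOf Γ, h0, hidx, c.comp (Subgroup.subgroupOfEquivOfLe hle).toMonoidHom,
    (Subgroup.subgroupOfEquivOfLe hle).symm x, (Subgroup.subgroupOfEquivOfLe hle).symm y, ?_⟩
  simpa only [MonoidHom.coe_comp, MulEquiv.coe_toMonoidHom, Function.comp_apply, MulEquiv.apply_symm_apply] using hne

/-- **HEADLINE: a graph with a finite `Aut`-stabiliser carries a skeleton of the ladder (any number of types) only if `Aut(G)` itself has a subgroup of
finite index `≤ |types| · |Stab(t)|` with a `ℤ²`-character of rank two killing the stabiliser of every vertex** (`Γ = ⊤` in `offWall_descends_of_frmScaled_qt`;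
the skeleton's own frames make `Aut(G)` quasi-transitive). [cite: BenjaminiSchramm1996, Conj. 4; §2 (almost transitive graphs)] -/
theorem aut_virtually_rankTwo_of_frmScaled (t : V) (hfin : {α : G ≃g G | α t = t}.Finite) (Φ : PlanarSkeletonFrmScaled G) :
    ∃ Γ₀ : Subgroup (G ≃g G), Γ₀.index ≠ 0 ∧ Γ₀.index ≤ Φ.types.card * {α : G ≃g G | α t = t}.ncard ∧
      ∃ c : Γ₀ →* Multiplicative (Site 2), (∀ (u : V) (h : Γ₀), (h : G ≃g G) u = u → c h = 1) ∧
        ∃ x y : Γ₀, MaxArea.det2 (Multiplicative.toAdd (c x)) (Multiplicative.toAdd (c y)) ≠ 0 := by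
  obtain ⟨Γ₀, -, h0, hidx, c, hc, x, y, hne⟩ := offWall_descends_of_frmScaled_qt t hfin Φ ⊤ Φ.types fun v => by
    obtain ⟨s, hs, α, hαs, -⟩ := Φ.frame v
    exact ⟨s, hs, α, Subgroup.mem_top α, hαs⟩
  rw [Subgroup.relIndex_top_right] at h0 hidx
  exact ⟨Γ₀, h0, hidx, c, hc, x, y, hne⟩

end QuasiTransitiveGraph

end AutDiscrete

end Summit.CriticalPhenomena.PercolationContinuityZ3.Theorems.Transplant

end
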